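import Summits.ValiantsHypothesis.ValiantsHypothesis.Theorems.BarrierLeverChowThinRowsTwinPeelSpan

/-!
# Route BarrierLever — item `ChowHitsThinRowPartitionMinors` (stmt-ValiantsHypothesis-20195):
# TWIN PEELING for the first-order-rows slice, II — the down-closed base and the peeling recursion

Helper file (`--supports stmt-ValiantsHypothesis-20195`; cell valiant-natproofs, rung V4, 𝒟-side of
door (c); prover seat valiant-natproofs-prover gen 11).  Closes NO item; imports only part I
`…ChowThinRowsTwinPeelSpan` (no route file).  Notation (`φ⁰_V`, `B_𝒦`, `E_V`, SPAN, POS) as there.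

THE BASE (`span_of_downClosed`, `coeff_prod_ne_zero_of_downClosed`): a DOWN-CLOSED family `𝒟` has
SPAN(𝒟, 𝒟) — prover g10's `leaveOneOut_independent_of_downClosed` says the square leave-one-out matrix
`[coeff_{y^W} E_V]_{V, W ∈ 𝒟}` is injective, hence surjective — and POS(𝒟, 𝒟) (the coefficients of
`B_𝒟` are positive integers on `𝒟`, `coeff_empty_prod_nat`).

THE RECURSION (`exists_forms_of_twinPeeling`): data = coordinates `cs 0, …, cs (p-1)` (pairwise
distinct) and twin bases `w0 t`; hypothesis = at each stage `t` (with `S_t = {cs s : s < t}` already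
peeled from every column) the coordinate `cs t` has AT MOST ONE TWIN PAIR in the peeled family
`{W \ S_t : W ∈ 𝒲}` (every peeled column `W \ S_t` not containing `cs t` whose twin
`(W \ S_t) ∪ {cs t}` is also a peeled column equals `w0 t`).  Conclusion: the family
`𝒦 = {{cs 0}, …, {cs (p-1)}} ∪ 𝒟`, `𝒟` the down-closure of the terminal family `{W \ S_p}`, has at
most `|𝒟| + p` members, lives inside `(⋃ 𝒲) ∪ S_p`, and has POS(𝒦, 𝒲) and SPAN(𝒦, 𝒲) — by
induction on `p`, peeling `cs 0` with part I's `span_insert_singleton` / `pos_insert_singleton` and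
shifting the remaining data to the peeled family `{W \ {cs 0}}`.

REACH (seat folder lab/peel*.py, exact enumeration): with `n = 4` column coordinates and the minimal
height `h = max(4, r-1)`, twin peeling (budget `|𝒟| + p ≤ 2h`) certifies 36 816 of the 38 260 column
families with `2 ≤ r ≤ 8` using all four coordinates; small shadow or affinely independent columns
(the previously landed kernel classes) cover 16 122, zero-twin peeling on top of them 24 098.  The
1 444 residual families (87 classes up to `S₄`, all of size 7 or 8 and containing `[4]`) have every
coordinate in at least two twin pairs.

WHAT THIS IS NOT: no statement about the 2-thick core (every coordinate in ≥ 2 twin pairs); nothing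
on rows of size 2, on items 20195 / 20172 / 19717 themselves, on crux stmt-ValiantsHypothesis-14610,
or on `VP` versus `VNP`.
-/

set_option linter.dupNamespace false

namespace Summit.ValiantsHypothesis.ValiantsHypothesis.Theorems.BarrierLever.ChowTwinPeel

open Finset MvPolynomial
open Summit.ValiantsHypothesis.ValiantsHypothesis.Theorems.BarrierLever.ChowSubcube
  (coeff_empty_prod_nat leaveOneOut_independent_of_downClosed)

variable {h : ℕ}

/-! ## 1. The base: a down-closed family spans itself -/

/-- **SPAN for a down-closed family** `𝒟` on its own members (prover g10's
`leaveOneOut_independent_of_downClosed`: the square leave-one-out matrix is injective, hence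
surjective). -/
theorem span_of_downClosed (DD : Finset (Finset (Fin h)))
    (hDD : ∀ W ∈ DD, ∀ U : Finset (Fin h), U ⊆ W → U ∈ DD) :
    ∀ g : Finset (Fin h) → ℂ, ∃ cV : Finset (Fin h) → ℂ, ∀ W ∈ DD,
      ∑ V ∈ DD, cV V * coeff (∑ a ∈ (∅ : Finset (Fin h)), Finsupp.single (Fin.castAdd h a) 1 +
          ∑ c' ∈ W, Finsupp.single (Fin.natAdd h c') 1)
        (∏ V' ∈ DD.erase V, (C 1 + ∑ a, C ((fun (_ : Fin h) (_ : Finset (Fin h)) =>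
          (0 : ℂ)) a V') * X (Fin.castAdd h a) + ∑ c', C (if c' ∈ V' then (1 : ℂ) else 0) *
          X (Fin.natAdd h c') : MvPolynomial (Fin (h + h)) ℂ)) = g W := by
  classical
  set ℰ : Matrix DD DD ℂ := Matrix.of fun V W =>
    coeff (∑ a ∈ (∅ : Finset (Fin h)), Finsupp.single (Fin.castAdd h a) 1 +
        ∑ c ∈ (W : Finset (Fin h)), Finsupp.single (Fin.natAdd h c) 1)
      (∏ V' ∈ DD.erase (V : Finset (Fin h)),
        (C 1 + ∑ a, C ((fun (_ : Fin h) (_ : Finset (Fin h)) => (0 : ℂ)) a V') * X (Fin.castAdd h a) +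
          ∑ c, C (if c ∈ V' then (1 : ℂ) else 0) * X (Fin.natAdd h c))) with hℰ
  have hinj : Function.Injective ℰ.vecMul := by
    intro c₁ c₂ hc
    rw [← sub_eq_zero]
    have h0 : Matrix.vecMul (c₁ - c₂) ℰ = 0 := by
      rw [Matrix.sub_vecMul]
      exact sub_eq_zero.mpr hc
    set c := c₁ - c₂ with hcdef
    let cV : Finset (Fin h) → ℂ := fun V => if hV : V ∈ DD then c ⟨V, hV⟩ else 0
    have hcV : ∀ W ∈ DD, ∑ V ∈ DD, cV V *
        coeff (∑ a ∈ (∅ : Finset (Fin h)), Finsupp.single (Fin.castAdd h a) 1 +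
            ∑ c ∈ W, Finsupp.single (Fin.natAdd h c) 1)
          (∏ V' ∈ DD.erase V, (C 1 + ∑ a, C ((fun (_ : Fin h) (_ : Finset (Fin h)) => (0 : ℂ)) a V') *
            X (Fin.castAdd h a) + ∑ c, C (if c ∈ V' then (1 : ℂ) else 0) * X (Fin.natAdd h c))) = 0 := by
      intro W hW
      have e := congr_fun h0 ⟨W, hW⟩
      change ∑ V : DD, c V * ℰ V ⟨W, hW⟩ = 0 at e
      have hsum : ∑ V ∈ DD, cV V *
          coeff (∑ a ∈ (∅ : Finset (Fin h)), Finsupp.single (Fin.castAdd h a) 1 +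
              ∑ c ∈ W, Finsupp.single (Fin.natAdd h c) 1)
            (∏ V' ∈ DD.erase V, (C 1 + ∑ a, C ((fun (_ : Fin h) (_ : Finset (Fin h)) => (0 : ℂ)) a V') *
              X (Fin.castAdd h a) + ∑ c, C (if c ∈ V' then (1 : ℂ) else 0) * X (Fin.natAdd h c))) =
          ∑ V : DD, c V * ℰ V ⟨W, hW⟩ := by
        rw [← Finset.sum_coe_sort DD]
        refine Finset.sum_congr rfl fun V _ => ?_
        simp only [cV, dif_pos V.2, hℰ, Matrix.of_apply, Subtype.coe_eta]
      rw [hsum]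
      exact e
    have hz := leaveOneOut_independent_of_downClosed DD hDD cV hcV
    funext V
    have := hz V V.2
    simp only [cV, dif_pos V.2] at this
    simpa using this
  have hsurj : Function.Surjective ℰ.vecMul :=
    Matrix.vecMul_surjective_iff_isUnit.mpr (Matrix.vecMul_injective_iff_isUnit.mp hinj)
  intro g
  obtain ⟨cvec, hcvec⟩ := hsurj (fun W : DD => g W)
  refine ⟨fun V => if hV : V ∈ DD then cvec ⟨V, hV⟩ else 0, fun W hW => ?_⟩
  have e := congr_fun hcvec ⟨W, hW⟩
  change ∑ V : DD, cvec V * ℰ V ⟨W, hW⟩ = g W at e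
  have hsum : ∑ V ∈ DD, (fun V => if hV : V ∈ DD then cvec ⟨V, hV⟩ else 0) V *
      coeff (∑ a ∈ (∅ : Finset (Fin h)), Finsupp.single (Fin.castAdd h a) 1 +
          ∑ c' ∈ W, Finsupp.single (Fin.natAdd h c') 1)
        (∏ V' ∈ DD.erase V, (C 1 + ∑ a, C ((fun (_ : Fin h) (_ : Finset (Fin h)) =>
          (0 : ℂ)) a V') * X (Fin.castAdd h a) + ∑ c', C (if c' ∈ V' then (1 : ℂ) else 0) *
          X (Fin.natAdd h c') : MvPolynomial (Fin (h + h)) ℂ)) = ∑ V : DD, cvec V * ℰ V ⟨W, hW⟩ := by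
    rw [← Finset.sum_coe_sort DD]
    refine Finset.sum_congr rfl fun V _ => ?_
    simp only [dif_pos V.2, hℰ, Matrix.of_apply, Subtype.coe_eta]
  rw [hsum]
  exact e

/-- **POS for a down-closed family**: `coeff_{y^W} B_𝒟` is a positive integer for `W ∈ 𝒟`. -/
theorem coeff_prod_ne_zero_of_downClosed (DD : Finset (Finset (Fin h)))
    (hDD : ∀ W ∈ DD, ∀ U : Finset (Fin h), U ⊆ W → U ∈ DD) (W : Finset (Fin h)) (hW : W ∈ DD) :
    coeff (∑ a ∈ (∅ : Finset (Fin h)), Finsupp.single (Fin.castAdd h a) 1 +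
        ∑ c' ∈ W, Finsupp.single (Fin.natAdd h c') 1)
      (∏ V ∈ DD, (C 1 + ∑ a, C ((fun (_ : Fin h) (_ : Finset (Fin h)) =>
        (0 : ℂ)) a V) * X (Fin.castAdd h a) + ∑ c', C (if c' ∈ V then (1 : ℂ) else 0) * X (Fin.natAdd h c') :
        MvPolynomial (Fin (h + h)) ℂ)) ≠ 0 := by
  obtain ⟨n, hn, hn1⟩ := coeff_empty_prod_nat (fun (_ : Fin h) (_ : Finset (Fin h)) => (0 : ℂ)) DD W
  have h1 : 1 ≤ n := hn1 fun c hc => hDD W hW {c} (Finset.singleton_subset_iff.mpr hc)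
  rw [hn]
  exact_mod_cast (by omega : n ≠ 0)

/-! ## 2. The recursion: peel `c 0, …, c (p-1)`, end with the down-closure -/

/-- Index shift for the set of already peeled coordinates. -/
theorem image_range_succ (cs : ℕ → Fin h) (t : ℕ) :
    (Finset.range (t + 1)).image cs = insert (cs 0) ((Finset.range t).image (fun s => cs (s + 1))) := by
  classical
  ext x
  simp only [Finset.mem_image, Finset.mem_range, Finset.mem_insert]
  constructor
  · rintro ⟨s, hs, rfl⟩
    cases s with
    | zero => exact Or.inl rfl
    | succ s => exact Or.inr ⟨s, by omega, rfl⟩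
  · rintro (rfl | ⟨s, hs, rfl⟩)
    · exact ⟨0, by omega, rfl⟩
    · exact ⟨s + 1, by omega, rfl⟩

/-- Peeling `c` first and then `S` is peeling `insert c S`. -/
theorem sdiff_insert_eq_erase_sdiff (W S : Finset (Fin h)) (c : Fin h) :
    W \ insert c S = W.erase c \ S := by
  classical
  ext d
  simp only [Finset.mem_sdiff, Finset.mem_insert, Finset.mem_erase, not_or]
  tauto

/-- The peeled column family after `insert c S` is the `S`-peel of the `c`-peel. -/
theorem image_sdiff_insert (𝒲 : Finset (Finset (Fin h))) (S : Finset (Fin h)) (c : Fin h) :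
    𝒲.image (fun W => W \ insert c S) = (𝒲.image (fun W => W.erase c)).image (fun W' => W' \ S) := by
  classical
  rw [Finset.image_image]
  refine Finset.image_congr fun W _ => ?_
  exact sdiff_insert_eq_erase_sdiff W S c

/-- **THE TWIN-PEELING RECURSION.**  Data: coordinates `cs 0, …, cs (p-1)` (pairwise distinct) and
twin bases `w0 0, …, w0 (p-1)`.  Hypothesis (stage `t < p`, with `S_t = {cs s : s < t}` already
peeled): every column `W ∈ 𝒲` with `cs t ∉ W` whose peeled set `W \ S_t` has its `cs t`-twin
`(W \ S_t) ∪ {cs t}` among the peeled columns `{W' \ S_t}` satisfies `W \ S_t = w0 t` — AT MOST ONE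
TWIN PAIR along `cs t` at stage `t`.  Conclusion: a family `𝒦` of at most `|𝒟| + p` sets, `𝒟` the
down-closure of the terminal family `{W \ S_p}`, all inside `(⋃ 𝒲) ∪ S_p`, whose indicator forms have
POS and SPAN on `𝒲`.  (`𝒦 = {{cs 0}} ∪ … ∪ {{cs (p-1)}} ∪ 𝒟`.) -/
theorem exists_forms_of_twinPeeling (p : ℕ) :
    ∀ (𝒲 : Finset (Finset (Fin h))) (cs : ℕ → Fin h) (w0 : ℕ → Finset (Fin h)),
      (∀ s, s < p → ∀ t, t < p → cs s = cs t → s = t) →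
      (∀ t, t < p → ∀ W ∈ 𝒲, cs t ∉ W →
        insert (cs t) (W \ (Finset.range t).image cs) ∈
          𝒲.image (fun W' => W' \ (Finset.range t).image cs) →
        W \ (Finset.range t).image cs = w0 t) →
      ∃ 𝒦 : Finset (Finset (Fin h)),
        𝒦.card ≤ ((𝒲.image (fun W => W \ (Finset.range p).image cs)).biUnion Finset.powerset).card + p ∧
        (∀ V ∈ 𝒦, V ⊆ 𝒲.sup id ∪ (Finset.range p).image cs) ∧
        (∀ W ∈ 𝒲, coeff (∑ a ∈ (∅ : Finset (Fin h)), Finsupp.single (Fin.castAdd h a) 1 +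
            ∑ c' ∈ W, Finsupp.single (Fin.natAdd h c') 1)
          (∏ V ∈ 𝒦, (C 1 + ∑ a, C ((fun (_ : Fin h) (_ : Finset (Fin h)) =>
            (0 : ℂ)) a V) * X (Fin.castAdd h a) + ∑ c', C (if c' ∈ V then (1 : ℂ) else 0) *
            X (Fin.natAdd h c') : MvPolynomial (Fin (h + h)) ℂ)) ≠ 0) ∧
        (∀ g : Finset (Fin h) → ℂ, ∃ cV : Finset (Fin h) → ℂ, ∀ W ∈ 𝒲,
          ∑ V ∈ 𝒦, cV V * coeff (∑ a ∈ (∅ : Finset (Fin h)), Finsupp.single (Fin.castAdd h a) 1 +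
              ∑ c' ∈ W, Finsupp.single (Fin.natAdd h c') 1)
            (∏ V' ∈ 𝒦.erase V, (C 1 + ∑ a, C ((fun (_ : Fin h) (_ : Finset (Fin h)) =>
              (0 : ℂ)) a V') * X (Fin.castAdd h a) + ∑ c', C (if c' ∈ V' then (1 : ℂ) else 0) *
              X (Fin.natAdd h c') : MvPolynomial (Fin (h + h)) ℂ)) = g W) := by
  classical
  induction p with
  | zero =>
    intro 𝒲 cs w0 _ _
    have h0 : (Finset.range 0).image cs = (∅ : Finset (Fin h)) := by simp
    simp only [h0, Finset.sdiff_empty, Finset.image_id', Finset.union_empty, add_zero]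
    -- the down-closure of `𝒲`
    set DD : Finset (Finset (Fin h)) := 𝒲.biUnion Finset.powerset with hDDdef
    have hDD : ∀ W ∈ DD, ∀ U : Finset (Fin h), U ⊆ W → U ∈ DD := by
      intro W hW U hU
      rw [hDDdef, Finset.mem_biUnion] at hW ⊢
      obtain ⟨W', hW', hWW'⟩ := hW
      exact ⟨W', hW', Finset.mem_powerset.mpr (hU.trans (Finset.mem_powerset.mp hWW'))⟩
    have h𝒲 : ∀ W ∈ 𝒲, W ∈ DD := fun W hW =>
      Finset.mem_biUnion.mpr ⟨W, hW, Finset.mem_powerset.mpr (subset_refl W)⟩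
    refine ⟨DD, le_rfl, ?_, ?_, ?_⟩
    · intro V hV
      rw [hDDdef, Finset.mem_biUnion] at hV
      obtain ⟨W, hW, hVW⟩ := hV
      exact (Finset.mem_powerset.mp hVW).trans (Finset.le_sup (f := id) hW)
    · intro W hW
      exact coeff_prod_ne_zero_of_downClosed DD hDD W (h𝒲 W hW)
    · intro g
      obtain ⟨cV, hcV⟩ := span_of_downClosed DD hDD g
      exact ⟨cV, fun W hW => hcV W (h𝒲 W hW)⟩
  | succ p ih =>
    intro 𝒲 cs w0 hinj htwin
    -- peel `c₀ = cs 0` first; the remaining data, shifted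
    set c₀ : Fin h := cs 0 with hc₀
    set 𝒲' : Finset (Finset (Fin h)) := 𝒲.image (fun W => W.erase c₀) with h𝒲'
    set cs' : ℕ → Fin h := fun s => cs (s + 1) with hcs'
    have hinj' : ∀ s, s < p → ∀ t, t < p → cs' s = cs' t → s = t := by
      intro s hs t ht hst
      have := hinj (s + 1) (by omega) (t + 1) (by omega) hst
      omega
    have hS : ∀ t, (Finset.range (t + 1)).image cs = insert c₀ ((Finset.range t).image cs') :=
      fun t => image_range_succ cs t
    have htwin' : ∀ t, t < p → ∀ W' ∈ 𝒲', cs' t ∉ W' →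
        insert (cs' t) (W' \ (Finset.range t).image cs') ∈
          𝒲'.image (fun W'' => W'' \ (Finset.range t).image cs') →
        W' \ (Finset.range t).image cs' = w0 (t + 1) := by
      intro t ht W' hW' hct hins
      rw [h𝒲', Finset.mem_image] at hW'
      obtain ⟨W, hW, rfl⟩ := hW'
      have hctW : cs (t + 1) ∉ W := by
        intro hcW
        have hne : cs (t + 1) ≠ c₀ := fun e => by
          have := hinj (t + 1) (by omega) 0 (by omega) e
          omega
        exact hct (Finset.mem_erase.mpr ⟨hne, hcW⟩)
      have e1 : W.erase c₀ \ (Finset.range t).image cs' = W \ (Finset.range (t + 1)).image cs := by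
        rw [hS, sdiff_insert_eq_erase_sdiff]
      have e2 : 𝒲'.image (fun W'' => W'' \ (Finset.range t).image cs') =
          𝒲.image (fun W'' => W'' \ (Finset.range (t + 1)).image cs) := by
        rw [hS t, image_sdiff_insert]
      rw [e1] at hins ⊢
      rw [e2] at hins
      exact htwin (t + 1) (by omega) W hW hctW hins
    obtain ⟨𝒦', hcard', hsupp', hpos', hspan'⟩ := ih 𝒲' cs' (fun t => w0 (t + 1)) hinj' htwin'
    -- the old forms avoid `c₀`
    have hfree : ∀ V ∈ 𝒦', c₀ ∉ V := by
      intro V hV hcV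
      rcases Finset.mem_union.mp (hsupp' V hV hcV) with h1 | h2
      · rw [Finset.mem_sup] at h1
        obtain ⟨W', hW', hcW'⟩ := h1
        rw [h𝒲', Finset.mem_image] at hW'
        obtain ⟨W, _, rfl⟩ := hW'
        exact Finset.notMem_erase c₀ W hcW'
      · rw [Finset.mem_image] at h2
        obtain ⟨s, hs, hcs⟩ := h2
        have := hinj (s + 1) (by rw [Finset.mem_range] at hs; omega) 0 (by omega) hcs
        omega
    -- the twin condition at stage `0`
    have htwin0 : ∀ W ∈ 𝒲, c₀ ∉ W → insert c₀ W ∈ 𝒲 → W = w0 0 := by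
      intro W hW hcW hins
      have e := htwin 0 (by omega) W hW hcW
      have h0 : (Finset.range 0).image cs = (∅ : Finset (Fin h)) := by simp
      simp only [h0, Finset.sdiff_empty, Finset.image_id'] at e
      exact e hins
    refine ⟨insert {c₀} 𝒦', ?_, ?_, ?_, ?_⟩
    · -- size
      have e2 : 𝒲'.image (fun W'' => W'' \ (Finset.range p).image cs') =
          𝒲.image (fun W'' => W'' \ (Finset.range (p + 1)).image cs) := by
        rw [hS p, image_sdiff_insert]
      rw [← e2]
      exact (Finset.card_insert_le _ _).trans (by omega)
    · -- support
      intro V hV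
      rw [Finset.mem_insert] at hV
      rcases hV with rfl | hV
      · intro x hx
        rw [Finset.mem_singleton] at hx
        subst hx
        exact Finset.mem_union_right _ (Finset.mem_image.mpr ⟨0, Finset.mem_range.mpr (by omega), rfl⟩)
      · intro x hx
        rcases Finset.mem_union.mp (hsupp' V hV hx) with h1 | h2
        · refine Finset.mem_union_left _ ?_
          rw [Finset.mem_sup] at h1 ⊢
          obtain ⟨W', hW', hxW'⟩ := h1
          rw [h𝒲', Finset.mem_image] at hW'
          obtain ⟨W, hW, rfl⟩ := hW'
          exact ⟨W, hW, Finset.mem_of_mem_erase hxW'⟩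
        · refine Finset.mem_union_right _ ?_
          rw [hS p]
          exact Finset.mem_insert_of_mem h2
    · -- POS
      refine pos_insert_singleton 𝒦' c₀ hfree 𝒲 fun W hW => hpos' (W.erase c₀) ?_
      rw [h𝒲']
      exact Finset.mem_image_of_mem _ hW
    · -- SPAN
      refine span_insert_singleton 𝒦' c₀ hfree 𝒲 (w0 0) htwin0 (fun W hW => hpos' (W.erase c₀) ?_) ?_
      · rw [h𝒲']
        exact Finset.mem_image_of_mem _ hW
      · intro g
        obtain ⟨cV, hcV⟩ := hspan' g
        exact ⟨cV, fun W hW => hcV (W.erase c₀) (by rw [h𝒲']; exact Finset.mem_image_of_mem _ hW)⟩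

end Summit.ValiantsHypothesis.ValiantsHypothesis.Theorems.BarrierLever.ChowTwinPeel
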